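import Mathlib
import Summits.ValiantsHypothesis.ValiantsHypothesis.Theorems.BarrierLeverPartitionMinorsHitByVPHiddenStatesDoublingFree

/-!
# Route BarrierLever — item `PartitionMinorsHitByVP` (stmt-ValiantsHypothesis-19717), line `hidden-states`:
# THE CO-HUB LIFT — a legal wide design for the lower cell `(n, 2^n − c)` with `m` pieces and `K` states gives one for
# `(n + 1, 2^{n+1} − c)` with `m + s` pieces and `K + 1` states, whenever `c ≤ s (K + 2)`

Helper file (`--supports stmt-ValiantsHypothesis-19717`; cell valiant-natproofs, rung V4, 𝒟-side door (c), registered line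
`Cruxes/PartitionMinorsHitByVP/Lines/hidden_states.lean` v8; prover seat val-np-p6 gen 14). Definition-free; closes NO item.
Numeric (node-format) form of `SymbJoin.symGood_double_free` (`…HiddenStatesDoublingFree`, this seat).

THE DESIGN. Old pieces `p ↦ castAdd s p` keep their columns on the old states `q ↦ castSucc q` (block A) and get a DOUBLED copy with
the marker `last K` added (block B; marker weight `0`, all other old weights and offsets tripled); `s` new STAR pieces `natAdd m i`
carry the `c` free columns: column `j < c` is the member `starSet (j mod (K+2))` of star piece `j div (K+2)`, where `starSet 0 = ∅` and
`starSet (t+1) = {t}` (block C). Star offsets `3B + 1` (`B` = the largest old column weight), star state weights `1` (used) / `2`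
(unused), empty star pieces get offset `3B + 3`: every design column weighs `≤ 3B + 2`, every non-column weighs `≥ 3B + 3` — the joint
STRICT threshold. Goodness for every lower `u`: `SymbJoin.symGood_double_free` with the star columns as the free block (a star is
affinely free: `φ = 1 − Σ y` isolates `∅`, `φ = y_t` isolates `{t}`).

* **`coHub_lift`** — the lift with explicit budgets `(m, K) ↦ (m + s, K + 1)`, hypothesis `c ≤ s (K + 2)`, `1 ≤ 2^n − c`.

The iteration from a two-star base and the resulting cells (LOWER node at `(h, 2^h − c)` for all `h` and all `c ≤ 2h³ − 2h + 2`; the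
`h = 19` window closed) are in the sequel `…HiddenStatesCoHubCells`.

WHAT THIS IS NOT: nothing in the bulk of the node; no stub of the line is closed; nothing on crux 14610 or VP ≠ VNP.
-/

set_option linter.dupNamespace false

namespace Summit.ValiantsHypothesis.ValiantsHypothesis.Theorems.BarrierLever.HiddenStates

open Finset Matrix MvPolynomial

noncomputable section

namespace CoHub

/-- Elements of `Fin (a + b + c)` come in three blocks. -/
theorem eq_three_blocks {a b c : ℕ} (k : Fin (a + b + c)) :
    (∃ j : Fin a, k = Fin.castAdd c (Fin.castAdd b j)) ∨ (∃ j : Fin b, k = Fin.castAdd c (Fin.natAdd a j)) ∨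
      ∃ j : Fin c, k = Fin.natAdd (a + b) j := by
  rcases SymbJoin.eq_castAdd_or_natAdd k with ⟨k', rfl⟩ | ⟨j, rfl⟩
  · rcases SymbJoin.eq_castAdd_or_natAdd k' with ⟨j, rfl⟩ | ⟨j, rfl⟩
    · exact Or.inl ⟨j, rfl⟩
    · exact Or.inr (Or.inl ⟨j, rfl⟩)
  · exact Or.inr (Or.inr ⟨j, rfl⟩)

/-- **THE CO-HUB LIFT.** A legal strict-threshold join design with `m` pieces on `K` states that serves every injective LOWER row
family of `r₁ = 2^n − c ≥ 1` subsets of `Fin n` yields one with `m + s` pieces on `K + 1` states serving every injective lower row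
family of `r₁ + r₁ + c = 2^{n+1} − c` subsets of `Fin (n+1)`, provided `c ≤ s (K + 2)` (the `c` free points fit into `s` stars). -/
theorem coHub_lift (n c m K r₁ s : ℕ) (hn : r₁ + c = 2 ^ n) (hr₁ : 1 ≤ r₁) (hcs : c ≤ s * (K + 2))
    (H : ∃ (W : Fin m → ℕ) (wt : Fin m → Fin K → ℕ) (e : Fin r₁ → Fin m × Finset (Fin K)),
      Function.Injective e ∧
      (∀ x : Fin m × Finset (Fin K), x ∉ Set.range e →
        ∀ i, W (e i).1 + ∑ k ∈ (e i).2, wt (e i).1 k < W x.1 + ∑ k ∈ x.2, wt x.1 k) ∧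
      ∀ u : Fin r₁ → Finset (Fin n), Function.Injective u → IsLowerSet (Set.range u) →
        ∃ tx : Fin m → Option (Fin K) → Fin n → ℂ,
          (Matrix.of fun i k : Fin r₁ =>
            ∏ a ∈ u i, (tx (e k).1 none a + ∑ q ∈ (e k).2, tx (e k).1 (some q) a)).det ≠ 0) :
    ∃ (W : Fin (m + s) → ℕ) (wt : Fin (m + s) → Fin (K + 1) → ℕ)
      (e : Fin (r₁ + r₁ + c) → Fin (m + s) × Finset (Fin (K + 1))),
      Function.Injective e ∧
      (∀ x : Fin (m + s) × Finset (Fin (K + 1)), x ∉ Set.range e →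
        ∀ i, W (e i).1 + ∑ k ∈ (e i).2, wt (e i).1 k < W x.1 + ∑ k ∈ x.2, wt x.1 k) ∧
      ∀ u : Fin (r₁ + r₁ + c) → Finset (Fin (n + 1)), Function.Injective u → IsLowerSet (Set.range u) →
        ∃ tx : Fin (m + s) → Option (Fin (K + 1)) → Fin (n + 1) → ℂ,
          (Matrix.of fun i k : Fin (r₁ + r₁ + c) =>
            ∏ a ∈ u i, (tx (e k).1 none a + ∑ q ∈ (e k).2, tx (e k).1 (some q) a)).det ≠ 0 := by
  classical
  obtain ⟨W, wt, e, he, hthr, hgood⟩ := H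
  -- ### the star members
  let starSet : ℕ → Finset (Fin (K + 1)) := fun t => Finset.univ.filter fun q : Fin (K + 1) => (q : ℕ) + 1 = t
  have hstar0 : starSet 0 = ∅ := by
    ext q; simp [starSet]
  have hstarS : ∀ q : Fin (K + 1), starSet ((q : ℕ) + 1) = {q} := by
    intro q; ext q'; simp [starSet, Fin.ext_iff]
  have hstar_cases : ∀ t, t ≤ K + 1 → t = 0 ∨ ∃ q : Fin (K + 1), t = (q : ℕ) + 1 := by
    intro t ht
    rcases Nat.eq_zero_or_pos t with rfl | hpos
    · exact Or.inl rfl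
    · exact Or.inr ⟨⟨t - 1, by omega⟩, by simp; omega⟩
  have hstar_inj : ∀ t t', t ≤ K + 1 → t' ≤ K + 1 → starSet t = starSet t' → t = t' := by
    intro t t' ht ht' htt
    rcases hstar_cases t ht with rfl | ⟨q, rfl⟩ <;> rcases hstar_cases t' ht' with rfl | ⟨q', rfl⟩
    · rfl
    · exfalso
      have : q' ∈ starSet 0 := by rw [htt, hstarS]; exact Finset.mem_singleton_self _
      rw [hstar0] at this; simp at this
    · exfalso
      have : q ∈ starSet 0 := by rw [← htt, hstarS]; exact Finset.mem_singleton_self _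
      rw [hstar0] at this; simp at this
    · rw [hstarS, hstarS, Finset.singleton_inj] at htt
      rw [htt]
  -- ### the three column blocks
  have hK2 : 0 < K + 2 := by omega
  have hdiv : ∀ j : Fin c, (j : ℕ) / (K + 2) < s := fun j =>
    (Nat.div_lt_iff_lt_mul hK2).mpr (lt_of_lt_of_le j.isLt hcs)
  have hmod : ∀ j : Fin c, (j : ℕ) % (K + 2) ≤ K + 1 := fun j => Nat.le_of_lt_succ (Nat.mod_lt _ hK2)
  have hAC : ∀ (p : Fin m) (i : Fin s), Fin.castAdd s p ≠ Fin.natAdd m i := by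
    intro p i hpi
    have := congrArg Fin.val hpi
    rw [Fin.val_castAdd, Fin.val_natAdd] at this
    have := p.isLt
    omega
  let eA : Fin r₁ → Fin (m + s) × Finset (Fin (K + 1)) :=
    fun j => (Fin.castAdd s (e j).1, ((e j).2).map Fin.castSuccEmb)
  let eB : Fin r₁ → Fin (m + s) × Finset (Fin (K + 1)) :=
    fun j => (Fin.castAdd s (e j).1, insert (Fin.last K) (((e j).2).map Fin.castSuccEmb))
  let eC : Fin c → Fin (m + s) × Finset (Fin (K + 1)) :=
    fun j => (Fin.natAdd m ⟨(j : ℕ) / (K + 2), hdiv j⟩, starSet ((j : ℕ) % (K + 2)))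
  let e' : Fin (r₁ + r₁ + c) → Fin (m + s) × Finset (Fin (K + 1)) := Fin.append (Fin.append eA eB) eC
  have heA : ∀ j, e' (Fin.castAdd c (Fin.castAdd r₁ j)) = eA j := by
    intro j; change Fin.append (Fin.append eA eB) eC _ = _; rw [Fin.append_left, Fin.append_left]
  have heB : ∀ j, e' (Fin.castAdd c (Fin.natAdd r₁ j)) = eB j := by
    intro j; change Fin.append (Fin.append eA eB) eC _ = _; rw [Fin.append_left, Fin.append_right]
  have heC : ∀ j, e' (Fin.natAdd (r₁ + r₁) j) = eC j := by
    intro j; change Fin.append (Fin.append eA eB) eC _ = _; rw [Fin.append_right]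
  have hlast_notMem : ∀ J : Finset (Fin K), Fin.last K ∉ J.map Fin.castSuccEmb := by
    intro J hJ
    obtain ⟨q, -, hq⟩ := Finset.mem_map.mp hJ
    exact (Fin.castSucc_lt_last q).ne hq
  -- a star column of piece `i` with member index `t` comes from `j = i (K+2) + t`
  have hCmem : ∀ (i : Fin s) (t : ℕ), t ≤ K + 1 → (i : ℕ) * (K + 2) + t < c →
      ((Fin.natAdd m i, starSet t) : Fin (m + s) × Finset (Fin (K + 1))) ∈ Set.range e' := by
    intro i t ht hlt
    refine ⟨Fin.natAdd (r₁ + r₁) ⟨(i : ℕ) * (K + 2) + t, hlt⟩, ?_⟩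
    rw [heC]
    have h1 : ((i : ℕ) * (K + 2) + t) / (K + 2) = i := by
      rw [Nat.add_comm, Nat.add_mul_div_right _ _ hK2, Nat.div_eq_of_lt (by omega), zero_add]
    have h2 : ((i : ℕ) * (K + 2) + t) % (K + 2) = t := by
      rw [Nat.add_comm, Nat.add_mul_mod_self_right, Nat.mod_eq_of_lt (by omega)]
    ext1
    · exact Fin.ext (by simp [eC, h1])
    · simp only [eC, h2]
  -- ### injectivity
  have he' : Function.Injective e' := by
    refine Fin.append_injective_iff.mpr ⟨Fin.append_injective_iff.mpr ⟨?_, ?_, ?_⟩, ?_, ?_⟩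
    · intro j j' hjj
      obtain ⟨h1, h2⟩ := Prod.ext_iff.mp hjj
      exact he (Prod.ext (Fin.castAdd_injective _ _ h1) (Finset.map_injective Fin.castSuccEmb h2))
    · intro j j' hjj
      obtain ⟨h1, h2⟩ := Prod.ext_iff.mp hjj
      refine he (Prod.ext (Fin.castAdd_injective _ _ h1) (Finset.map_injective Fin.castSuccEmb ?_))
      have := congrArg (fun J => Finset.erase J (Fin.last K)) h2
      simpa only [eB, Finset.erase_insert (hlast_notMem _)] using this
    · intro j j' hjj
      have h2 := (Prod.ext_iff.mp hjj).2
      simp only [eA, eB] at h2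
      exact hlast_notMem (e j).2 (h2 ▸ Finset.mem_insert_self _ _)
    · intro j j' hjj
      obtain ⟨h1, h2⟩ := Prod.ext_iff.mp hjj
      simp only [eC] at h1 h2
      have hi : (j : ℕ) / (K + 2) = (j' : ℕ) / (K + 2) := by
        have := Fin.ext_iff.mp (Fin.natAdd_injective _ _ h1); simpa using this
      have ht : (j : ℕ) % (K + 2) = (j' : ℕ) % (K + 2) := hstar_inj _ _ (hmod j) (hmod j') h2
      exact Fin.ext (by rw [← Nat.div_add_mod (j : ℕ) (K + 2), ← Nat.div_add_mod (j' : ℕ) (K + 2), hi, ht])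
    · intro k j hkj
      have h1 := (Prod.ext_iff.mp hkj).1
      rcases SymbJoin.eq_castAdd_or_natAdd k with ⟨j₀, rfl⟩ | ⟨j₀, rfl⟩
      · rw [Fin.append_left] at h1; exact hAC _ _ h1
      · rw [Fin.append_right] at h1; exact hAC _ _ h1
  -- ### weights
  let wOld : Fin r₁ → ℕ := fun i => W (e i).1 + ∑ k ∈ (e i).2, wt (e i).1 k
  obtain ⟨B, hBdef⟩ : ∃ B : ℕ, B = Finset.univ.sup wOld := ⟨_, rfl⟩
  have hBle : ∀ i, wOld i ≤ B := fun i => hBdef ▸ Finset.le_sup (Finset.mem_univ i)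
  have hBlt : ∀ x : Fin m × Finset (Fin K), x ∉ Set.range e → B < W x.1 + ∑ k ∈ x.2, wt x.1 k := by
    intro x hx
    have hne : (Finset.univ : Finset (Fin r₁)).Nonempty := ⟨⟨0, hr₁⟩, Finset.mem_univ _⟩
    obtain ⟨i₀, -, hi₀⟩ := Finset.exists_mem_eq_sup Finset.univ hne wOld
    rw [hBdef, hi₀]
    exact hthr x hx i₀
  let W' : Fin (m + s) → ℕ :=
    Fin.append (fun p => 3 * W p) (fun i => if (i : ℕ) * (K + 2) < c then 3 * B + 1 else 3 * B + 3)
  let wt' : Fin (m + s) → Fin (K + 1) → ℕ :=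
    Fin.append (fun p q => Fin.lastCases 0 (fun q₀ => 3 * wt p q₀) q)
      (fun i q => if (i : ℕ) * (K + 2) + ((q : ℕ) + 1) < c then 1 else 2)
  have hW'A : ∀ p, W' (Fin.castAdd s p) = 3 * W p := fun p => Fin.append_left _ _ p
  have hW'C : ∀ i : Fin s, W' (Fin.natAdd m i) = if (i : ℕ) * (K + 2) < c then 3 * B + 1 else 3 * B + 3 :=
    fun i => Fin.append_right _ _ i
  have hwt'A : ∀ p, wt' (Fin.castAdd s p) = fun q => Fin.lastCases 0 (fun q₀ => 3 * wt p q₀) q :=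
    fun p => Fin.append_left _ _ p
  have hwt'Ac : ∀ p q, wt' (Fin.castAdd s p) (Fin.castSucc q) = 3 * wt p q := by
    intro p q; rw [hwt'A]
    show Fin.lastCases 0 (fun q₀ => 3 * wt p q₀) (Fin.castSucc q) = 3 * wt p q
    exact Fin.lastCases_castSucc q
  have hwt'Al : ∀ p, wt' (Fin.castAdd s p) (Fin.last K) = 0 := by
    intro p; rw [hwt'A]
    show Fin.lastCases 0 (fun q₀ => 3 * wt p q₀) (Fin.last K) = 0
    exact Fin.lastCases_last
  have hwt'C : ∀ (i : Fin s) q, wt' (Fin.natAdd m i) q = if (i : ℕ) * (K + 2) + ((q : ℕ) + 1) < c then 1 else 2 := by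
    intro i q
    have : wt' (Fin.natAdd m i) = fun q : Fin (K + 1) => if (i : ℕ) * (K + 2) + ((q : ℕ) + 1) < c then 1 else 2 :=
      Fin.append_right (fun (p : Fin m) (q : Fin (K + 1)) => Fin.lastCases 0 (fun q₀ => 3 * wt p q₀) q)
        (fun (i : Fin s) (q : Fin (K + 1)) => if (i : ℕ) * (K + 2) + ((q : ℕ) + 1) < c then 1 else 2) i
    rw [this]
  -- weight of an old-type state set
  have hsumA : ∀ (p : Fin m) (J : Finset (Fin K)),
      ∑ k ∈ J.map Fin.castSuccEmb, wt' (Fin.castAdd s p) k = 3 * ∑ k ∈ J, wt p k := by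
    intro p J
    rw [Finset.sum_map, Finset.mul_sum]
    exact Finset.sum_congr rfl fun q _ => hwt'Ac p q
  have hsumB : ∀ (p : Fin m) (J : Finset (Fin K)),
      ∑ k ∈ insert (Fin.last K) (J.map Fin.castSuccEmb), wt' (Fin.castAdd s p) k = 3 * ∑ k ∈ J, wt p k := by
    intro p J
    rw [Finset.sum_insert (hlast_notMem J), hwt'Al, zero_add, hsumA]
  -- every design column weighs at most `3B + 2`
  have hused : ∀ k, W' (e' k).1 + ∑ q ∈ (e' k).2, wt' (e' k).1 q ≤ 3 * B + 2 := by
    intro k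
    rcases eq_three_blocks k with ⟨j, rfl⟩ | ⟨j, rfl⟩ | ⟨j, rfl⟩
    · rw [heA]; simp only [eA]; rw [hW'A, hsumA]; have := hBle j; simp only [wOld] at this; omega
    · rw [heB]; simp only [eB]; rw [hW'A, hsumB]; have := hBle j; simp only [wOld] at this; omega
    · rw [heC]
      show W' (Fin.natAdd m ⟨(j : ℕ) / (K + 2), hdiv j⟩) +
          ∑ q ∈ starSet ((j : ℕ) % (K + 2)), wt' (Fin.natAdd m ⟨(j : ℕ) / (K + 2), hdiv j⟩) q ≤ 3 * B + 2
      rw [hW'C]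
      have hjc : (((⟨(j : ℕ) / (K + 2), hdiv j⟩ : Fin s) : ℕ)) * (K + 2) < c :=
        lt_of_le_of_lt (Nat.div_mul_le_self _ _) j.isLt
      rw [if_pos hjc]
      rcases hstar_cases _ (hmod j) with h0 | ⟨q, hq⟩
      · rw [h0, hstar0, Finset.sum_empty]; omega
      · rw [hq, hstarS, Finset.sum_singleton, hwt'C]
        have hjq : (((⟨(j : ℕ) / (K + 2), hdiv j⟩ : Fin s) : ℕ)) * (K + 2) + ((q : ℕ) + 1) < c := by
          rw [← hq]
          show (j : ℕ) / (K + 2) * (K + 2) + (j : ℕ) % (K + 2) < c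
          rw [Nat.div_add_mod']
          exact j.isLt
        rw [if_pos hjq]
  -- every non-column weighs at least `3B + 3`
  have hunused : ∀ x : Fin (m + s) × Finset (Fin (K + 1)), x ∉ Set.range e' →
      3 * B + 3 ≤ W' x.1 + ∑ q ∈ x.2, wt' x.1 q := by
    rintro ⟨p', J'⟩ hx
    rcases SymbJoin.eq_castAdd_or_natAdd p' with ⟨p, rfl⟩ | ⟨i, rfl⟩
    · -- an old piece: pull the state set back to `Fin K`
      let J₀ : Finset (Fin K) := Finset.univ.filter fun q => Fin.castSucc q ∈ J'
      have hJ₀ : J'.erase (Fin.last K) = J₀.map Fin.castSuccEmb := by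
        ext k
        simp only [Finset.mem_erase, Finset.mem_map, Finset.mem_filter, Finset.mem_univ, true_and,
          Fin.castSuccEmb_apply, J₀]
        constructor
        · rintro ⟨hk, hkJ⟩
          rcases Fin.eq_castSucc_or_eq_last k with ⟨q, rfl⟩ | rfl
          · exact ⟨q, hkJ, rfl⟩
          · exact absurd rfl hk
        · rintro ⟨q, hq, rfl⟩
          exact ⟨(Fin.castSucc_lt_last q).ne, hq⟩
      have hnot : ((p, J₀) : Fin m × Finset (Fin K)) ∉ Set.range e := by
        rintro ⟨j, hj⟩
        apply hx
        by_cases hl : Fin.last K ∈ J'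
        · refine ⟨Fin.castAdd c (Fin.natAdd r₁ j), ?_⟩
          rw [heB]; simp only [eB, hj]
          rw [← hJ₀, Finset.insert_erase hl]
        · refine ⟨Fin.castAdd c (Fin.castAdd r₁ j), ?_⟩
          rw [heA]; simp only [eA, hj]
          rw [← hJ₀, Finset.erase_eq_of_notMem hl]
      have hB3 := hBlt _ hnot
      simp only at hB3
      show 3 * B + 3 ≤ W' (Fin.castAdd s p) + ∑ q ∈ J', wt' (Fin.castAdd s p) q
      rw [hW'A]
      by_cases hl : Fin.last K ∈ J'
      · rw [← Finset.insert_erase hl, hJ₀, hsumB]; omega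
      · rw [← Finset.erase_eq_of_notMem hl, hJ₀, hsumA]; omega
    · -- a star piece
      show 3 * B + 3 ≤ W' (Fin.natAdd m i) + ∑ q ∈ J', wt' (Fin.natAdd m i) q
      rw [hW'C]
      have hwt1 : ∀ q ∈ J', 1 ≤ wt' (Fin.natAdd m i) q := fun q _ => by rw [hwt'C]; split_ifs <;> omega
      have hcard_le : J'.card ≤ ∑ q ∈ J', wt' (Fin.natAdd m i) q := by
        rw [Finset.card_eq_sum_ones]; exact Finset.sum_le_sum hwt1
      by_cases hic : (i : ℕ) * (K + 2) < c
      · rw [if_pos hic]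
        -- `J'` is neither `∅` nor a used singleton
        by_cases h2 : 2 ≤ J'.card
        · have := le_trans h2 hcard_le; omega
        rcases Nat.lt_or_ge J'.card 1 with h0 | h1
        · exfalso
          have hJ : J' = ∅ := Finset.card_eq_zero.mp (show J'.card = 0 by omega)
          have hmem := hCmem i 0 (Nat.zero_le _) (by rw [add_zero]; exact hic)
          rw [hstar0, ← hJ] at hmem
          exact hx hmem
        · obtain ⟨q, hq⟩ := Finset.card_eq_one.mp (show J'.card = 1 by omega)
          subst hq
          rw [Finset.sum_singleton, hwt'C]
          by_cases hq' : (i : ℕ) * (K + 2) + ((q : ℕ) + 1) < c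
          · exfalso
            have hmem := hCmem i ((q : ℕ) + 1) (by omega) hq'
            rw [hstarS] at hmem
            exact hx hmem
          · rw [if_neg hq']
      · rw [if_neg hic]; omega
  refine ⟨W', wt', e', he', fun x hx i => lt_of_le_of_lt (hused i) (Nat.lt_of_succ_le (hunused x hx)), ?_⟩
  -- ### goodness, by the symbolic doubling theorem
  intro u hu hlow
  refine SymbJoin.exists_table_of_symGood u e' (SymbJoin.symGood_double_free e ?_ hn u hu hlow rfl (Fin.last n) e'
    (fun j => Fin.castAdd c (Fin.castAdd r₁ j)) (fun j => Fin.castAdd c (Fin.natAdd r₁ j)) (Fin.natAdd (r₁ + r₁)) ?_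
    (Fin.castAddEmb s) Fin.castSuccEmb (Fin.last K) ?_ ?_ ?_ ?_)
  · intro w hw hwlow
    obtain ⟨tx, htx⟩ := hgood w hw hwlow
    exact SymbJoin.symGood_of_table w e tx htx
  · -- the three blocks enumerate `Fin (r₁ + r₁ + c)` injectively
    have : Sum.elim (Sum.elim (fun j => Fin.castAdd c (Fin.castAdd r₁ j)) (fun j => Fin.castAdd c (Fin.natAdd r₁ j)))
        (Fin.natAdd (r₁ + r₁)) = ⇑((finSumFinEquiv (m := r₁) (n := r₁)).sumCongr (Equiv.refl (Fin c)) |>.trans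
          (finSumFinEquiv (m := r₁ + r₁) (n := c))) := by
      funext i; rcases i with (i | i) | i <;> simp
    rw [this]; exact Equiv.injective _
  · rintro ⟨q, hq⟩; exact (Fin.castSucc_lt_last q).ne hq
  · intro j; rw [heA]; rfl
  · intro j; rw [heB]; rfl
  · -- the star columns are affinely free inside their pieces
    intro j
    rw [heC]
    rcases hstar_cases _ (hmod j) with h0 | ⟨q, hq⟩
    · -- the empty member: `φ = 1 − Σ_q y_q`
      refine ⟨fun o => Option.elim o 1 fun _ => -1, ?_, ?_⟩
      · simp only [eC, h0, hstar0, SymbJoin.phi, Finset.sum_empty, add_zero, Option.elim]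
      · intro k' hk' hp
        rcases eq_three_blocks k' with ⟨j', rfl⟩ | ⟨j', rfl⟩ | ⟨j', rfl⟩
        · rw [heA] at hp; exact absurd hp (hAC _ _)
        · rw [heB] at hp; exact absurd hp (hAC _ _)
        · rw [heC] at hp ⊢
          simp only [eC] at hp ⊢
          have hi : (j' : ℕ) / (K + 2) = (j : ℕ) / (K + 2) := by
            have := Fin.ext_iff.mp (Fin.natAdd_injective _ _ hp); simpa using this
          have ht : (j' : ℕ) % (K + 2) ≠ (j : ℕ) % (K + 2) := by
            intro ht
            apply hk'
            congr 1
            exact Fin.ext (by rw [← Nat.div_add_mod (j' : ℕ) (K + 2), ← Nat.div_add_mod (j : ℕ) (K + 2), hi, ht])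
          rcases hstar_cases _ (hmod j') with h0' | ⟨q', hq'⟩
          · exact absurd (h0'.trans h0.symm) ht
          · rw [hq', hstarS]; simp [SymbJoin.phi]
    · -- the singleton member `{q}`: `φ = y_q`
      refine ⟨fun o => Option.elim o 0 fun q'' => if q'' = q then 1 else 0, ?_, ?_⟩
      · simp only [eC, hq, hstarS, SymbJoin.phi, Finset.sum_singleton, Option.elim, if_true, zero_add]
      · intro k' hk' hp
        rcases eq_three_blocks k' with ⟨j', rfl⟩ | ⟨j', rfl⟩ | ⟨j', rfl⟩
        · rw [heA] at hp; exact absurd hp (hAC _ _)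
        · rw [heB] at hp; exact absurd hp (hAC _ _)
        · rw [heC] at hp ⊢
          simp only [eC] at hp ⊢
          have hi : (j' : ℕ) / (K + 2) = (j : ℕ) / (K + 2) := by
            have := Fin.ext_iff.mp (Fin.natAdd_injective _ _ hp); simpa using this
          have ht : (j' : ℕ) % (K + 2) ≠ (j : ℕ) % (K + 2) := by
            intro ht
            apply hk'
            congr 1
            exact Fin.ext (by rw [← Nat.div_add_mod (j' : ℕ) (K + 2), ← Nat.div_add_mod (j : ℕ) (K + 2), hi, ht])
          rcases hstar_cases _ (hmod j') with h0' | ⟨q', hq'⟩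
          · rw [h0', hstar0]; simp [SymbJoin.phi]
          · rw [hq', hstarS]
            have hqq : q' ≠ q := by
              intro hqq; apply ht; rw [hq', hq, hqq]
            simp only [SymbJoin.phi, Finset.sum_singleton, Option.elim, hqq, if_false, zero_add]

end CoHub

end

end Summit.ValiantsHypothesis.ValiantsHypothesis.Theorems.BarrierLever.HiddenStates
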